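import Literature.Computability.Complexity.DrivenSignMachineStrategy
import Literature.Computability.Complexity.FKFinalCheck
import HarnessLib

/-!
# Fournier–Koiran transfer, assembly: `L ∈ P⁰_ℝovs(NP)` from a located frame strategy

Topic `Literature/Computability/Complexity`, grouping namespace `FKTransfer`. This file assembles
the machine-free reduction of Fournier–Koiran's Theorem 3 (ICALP 2000 = LIP RR-1999-21, p. 11:
`NP⁰_ℝovs ⊆ P⁰_ℝovs(NP)`, in the tree `NDPAdd ⊆ PAddRelClass NP`,
`FournierKoiranTransfer.fournierKoiran2000_NDPAdd_subset_PAddRelClass_NP`) built in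
`DrivenSignMachine*.lean` (the universal driven sign machine and its stream), `SignRat.lean` /
`FKFinalCheck.lean` (the final `NP` question at a rational point) into ONE statement,
**`mem_PAddRelClass_of_strategy`**, whose hypotheses are exactly what a point-location procedure in
the style of the report's §2 has to deliver, dimension by dimension, for a real language `L`
presented in `NDPAdd` form by a verifier `M` (budget `q`, query-length bound `T`):

1. a frame strategy (`R n`, `code n`) with block sizes `s(n)`, `m(n)` and `F(n)` frames
   (polynomials), IMPLEMENTED by a driver language `A` (`DrivenSignMachineStrategy.Implements`:
   prefix search, then transmission) — with `A` in the oracle class `C` (for Theorem 3: `C = NP`);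
2. EXISTENCE of admissible witnesses after every valid history (the geometry of §2.1: coarseness,
   chains, apexes — `FKPointLocationLevel.lean` and its sequels provide these);
3. a rational point `point n h = (d, N)` read off every valid full history, lying in the face of
   the input: the sign oracles of `x` and of `N/d` agree on every query the verifier can ask
   (§2.4 and p. 11; in the tree `FKPointLocationCertificates.Cert.sign_lin_xStar_eq` with
   `FournierKoiranTransferOracle.signOracle_eq_of_sign_agree`);
4. the driver's LAST answer, on the full transcript, is the final check
   `⟨1ⁿ, ratCode d N⟩ ∈ FinalCheck M q T` (an `NP` language, `FKFinalCheck.FinalCheck_mem_NP`).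

Conclusion: `L ∈ PAddRelClass C`. No hypothesis is a named fact; (1)–(4) are data and proofs the
caller supplies. What is NOT here: any particular strategy (the report's §2), and the proof that a
particular driver language is in `NP`.

## References

* H. Fournier, P. Koiran, *Lower bounds are not easier over the reals: inside PH*, ICALP 2000,
  LNCS 1853 = LIP RR-1999-21, §2 (location), §3 Thm 3 (p. 11). [FournierKoiran2000]
-/

namespace Literature.Computability.Complexity

namespace FKTransfer

open _root_.Computability Polynomial

/-- **`L ∈ P⁰_ℝovs(C)` from a located frame strategy** (the assembly of Fournier–Koiran's
Theorem 3 in the driven-machine decomposition; see the module docstring for the four hypotheses).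
The machine is `drvAlg m (s + m + 1) (F * (s + m + 1))` with the oracle `A`.
[cite: FournierKoiran2000, Thm 3 (p. 11)] -/
theorem mem_PAddRelClass_of_strategy {L : RealLanguage} {C : Set (Language Bool)}
    -- the `NDPAdd` presentation of `L`
    (M : OracleAlg Bool) (q T : Polynomial ℕ)
    (hL : ∀ (n : ℕ) (x : Fin n → ℝ), x ∈ L n ↔ ∃ y : List Bool, y.length ≤ q.eval n ∧
      M.run (signOracle x) (q.eval n) (boolPair (unaryEncodeNat n) y) = some true)
    (hT : ∀ (n : ℕ) (y : List Bool), y.length ≤ q.eval n →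
      ∀ ans : List (List Bool), (∀ a ∈ ans, a.length = 1) → ans.length ≤ q.eval n →
        ∀ qry, M.step (boolPair (unaryEncodeNat n) y) ans = Sum.inl qry → qry.length ≤ T.eval n)
    -- the strategy, dimension by dimension, and its driver
    (s m F : Polynomial ℕ)
    (R : ℕ → List (List Bool × Bool) → List Bool → Prop)
    (code : ℕ → List (List Bool × Bool) → List Bool → List Bool)
    (point : ℕ → List (List Bool × Bool) → ℕ × List ℤ)
    {A : Language Bool} (hA : A ∈ C)
    (hcode : ∀ n h w, (code n h w).length = m.eval n)
    (hs : ∀ n h w, R n h w → w.length = s.eval n)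
    (himpl : ∀ (n : ℕ) (x : Fin n → ℝ),
      Implements (R n) (code n) (signEnv x) (driverOf A n) (s.eval n) (F.eval n))
    -- (2) witnesses exist along valid histories
    (hex : ∀ (n : ℕ) (x : Fin n → ℝ) (h : List (List Bool × Bool)), h.length < F.eval n →
      ValidHist (R n) (code n) (signEnv x) h → ∃ w : List Bool, w.length = s.eval n ∧ R n h w)
    -- (3) the point read off a valid full history lies in the face of `x`
    (hpoint : ∀ (n : ℕ) (x : Fin n → ℝ) (h : List (List Bool × Bool)), h.length = F.eval n →
      ValidHist (R n) (code n) (signEnv x) h →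
        0 < (point n h).1 ∧
        ∀ y : List Bool, y.length ≤ q.eval n →
          ∀ ans : List (List Bool), (∀ a ∈ ans, a.length = 1) → ans.length < q.eval n →
            ∀ qry, M.step (boolPair (unaryEncodeNat n) y) ans = Sum.inl qry →
              signOracle x qry = signOracle (ratPoint (point n h).1 (point n h).2) qry)
    -- (4) the driver's last answer is the final check at that point
    (hfinal : ∀ (n : ℕ) (x : Fin n → ℝ) (h : List (List Bool × Bool)), h.length = F.eval n →
      ValidHist (R n) (code n) (signEnv x) h →
        (boolPair (unaryEncodeNat n) (flat (code n) h) ∈ A ↔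
          boolPair (unaryEncodeNat n) (ratCode (point n h).1 (point n h).2) ∈ FinalCheck M q T)) :
    L ∈ PAddRelClass C := by
  refine mem_PAddRelClass_of_driver m (s + m + 1) (F * (s + m + 1)) hA L fun n x => ?_
  have hP : (s + m + 1 : Polynomial ℕ).eval n = s.eval n + m.eval n + 1 := by
    simp only [eval_add, eval_one]
  have hTn : (F * (s + m + 1) : Polynomial ℕ).eval n = F.eval n * (s.eval n + m.eval n + 1) := by
    rw [eval_mul, hP]
  obtain ⟨h, hlen, hv, hstream⟩ :=
    exists_validHist_stream_T (δ := driverOf A n) (σ := signEnv x) (himpl n x) (hcode n) (hs n) (hex n x)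
  rw [hP, hTn, hstream, hfinal n x h hlen hv]
  obtain ⟨hd, hagree⟩ := hpoint n x h hlen hv
  rw [mem_FinalCheck_iff_of_agree hT hd (point n h).2 n x hagree]
  exact (hL n x).symm

/-- **The `NP` case**: with a driver language in `NP`, `L ∈ P⁰_ℝovs(NP)` — the shape of the tree's
fact `fournierKoiran2000_NDPAdd_subset_PAddRelClass_NP` for the language `L`.
[cite: FournierKoiran2000, Thm 3 (p. 11)] -/
theorem mem_PAddRelClass_NP_of_strategy {L : RealLanguage}
    (M : OracleAlg Bool) (q T : Polynomial ℕ)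
    (hL : ∀ (n : ℕ) (x : Fin n → ℝ), x ∈ L n ↔ ∃ y : List Bool, y.length ≤ q.eval n ∧
      M.run (signOracle x) (q.eval n) (boolPair (unaryEncodeNat n) y) = some true)
    (hT : ∀ (n : ℕ) (y : List Bool), y.length ≤ q.eval n →
      ∀ ans : List (List Bool), (∀ a ∈ ans, a.length = 1) → ans.length ≤ q.eval n →
        ∀ qry, M.step (boolPair (unaryEncodeNat n) y) ans = Sum.inl qry → qry.length ≤ T.eval n)
    (s m F : Polynomial ℕ)
    (R : ℕ → List (List Bool × Bool) → List Bool → Prop)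
    (code : ℕ → List (List Bool × Bool) → List Bool → List Bool)
    (point : ℕ → List (List Bool × Bool) → ℕ × List ℤ)
    {A : Language Bool} (hA : A ∈ Nondeterministic.NP)
    (hcode : ∀ n h w, (code n h w).length = m.eval n)
    (hs : ∀ n h w, R n h w → w.length = s.eval n)
    (himpl : ∀ (n : ℕ) (x : Fin n → ℝ),
      Implements (R n) (code n) (signEnv x) (driverOf A n) (s.eval n) (F.eval n))
    (hex : ∀ (n : ℕ) (x : Fin n → ℝ) (h : List (List Bool × Bool)), h.length < F.eval n →
      ValidHist (R n) (code n) (signEnv x) h → ∃ w : List Bool, w.length = s.eval n ∧ R n h w)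
    (hpoint : ∀ (n : ℕ) (x : Fin n → ℝ) (h : List (List Bool × Bool)), h.length = F.eval n →
      ValidHist (R n) (code n) (signEnv x) h →
        0 < (point n h).1 ∧
        ∀ y : List Bool, y.length ≤ q.eval n →
          ∀ ans : List (List Bool), (∀ a ∈ ans, a.length = 1) → ans.length < q.eval n →
            ∀ qry, M.step (boolPair (unaryEncodeNat n) y) ans = Sum.inl qry →
              signOracle x qry = signOracle (ratPoint (point n h).1 (point n h).2) qry)
    (hfinal : ∀ (n : ℕ) (x : Fin n → ℝ) (h : List (List Bool × Bool)), h.length = F.eval n →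
      ValidHist (R n) (code n) (signEnv x) h →
        (boolPair (unaryEncodeNat n) (flat (code n) h) ∈ A ↔
          boolPair (unaryEncodeNat n) (ratCode (point n h).1 (point n h).2) ∈ FinalCheck M q T)) :
    L ∈ PAddRelClass Nondeterministic.NP :=
  mem_PAddRelClass_of_strategy M q T hL hT s m F R code point hA hcode hs himpl hex hpoint hfinal

end FKTransfer

end Literature.Computability.Complexity
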